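import Mathlib.Analysis.Calculus.InverseFunctionTheorem.FDeriv
import Mathlib.Analysis.Calculus.ContDiff.RCLike
import Mathlib.Analysis.InnerProductSpace.PiL2
import Mathlib.Analysis.Normed.Module.FiniteDimension
import Mathlib.Algebra.Module.Projective

/-!
# Dense subspaces meet regular zero sets of `C¹` maps to `ℝᵏ`

Let `E` be a real Banach space, `D ≤ E` a dense linear subspace and
`F : E → ℝᵏ` a `C¹` map with `F x₀ = 0` and `DF(x₀)` onto.  Then `D` contains zeros of `F`
arbitrarily close to `x₀`.

Proof sketch.  Since `DF(x₀)` is onto and `D` is dense, `DF(x₀)(D)` is a dense, hence full,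
subspace of the finite-dimensional space `ℝᵏ`; so `DF(x₀)` admits a (continuous) linear right
inverse `R : ℝᵏ → E` with values in `D`.  For `x' ∈ D` close to `x₀`, the finite-dimensional map
`G c := F (x' + R c)` approximates the identity on a small closed ball (strict differentiability
of `F` at `x₀`), so by the quantitative surjectivity lemma
`ApproximatesLinearOn.surjOn_closedBall_of_nonlinearRightInverse` it hits `0 = lim F x'` at some
small `c`; the point `x' + R c` lies in `D`, is close to `x₀`, and is a zero of `F`.
-/

set_option linter.dupNamespace false

noncomputable section

open Set Metric Topology NNReal

namespace Summit.NavierStokesRegularity.NavierStokesRegularity.Theorems.PumpContinuationDenseMeetsFiniteCodim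

/-- A continuous linear surjection onto `ℝᵏ` admits a continuous linear right inverse taking
values in any prescribed dense subspace `D` of the source. -/
private theorem exists_rightInverse_mem {E : Type*} [NormedAddCommGroup E] [NormedSpace ℝ E]
    {k : ℕ} (D : Submodule ℝ E) (hD : Dense (D : Set E))
    (A : E →L[ℝ] EuclideanSpace ℝ (Fin k)) (hA : Function.Surjective A) :
    ∃ R : EuclideanSpace ℝ (Fin k) →L[ℝ] E, (∀ c, R c ∈ D) ∧ ∀ c, A (R c) = c := by
  have hdense : Dense ((D.map (A : E →ₗ[ℝ] EuclideanSpace ℝ (Fin k))) :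
      Set (EuclideanSpace ℝ (Fin k))) := by
    rw [Submodule.map_coe]
    exact hA.denseRange.dense_image A.continuous hD
  have hclosed : IsClosed ((D.map (A : E →ₗ[ℝ] EuclideanSpace ℝ (Fin k))) :
      Set (EuclideanSpace ℝ (Fin k))) :=
    Submodule.closed_of_finiteDimensional _
  have htop : D.map (A : E →ₗ[ℝ] EuclideanSpace ℝ (Fin k)) = ⊤ := by
    rw [← Submodule.coe_eq_univ, ← hclosed.closure_eq, hdense.closure_eq]
  have hrange :
      LinearMap.range ((A : E →ₗ[ℝ] EuclideanSpace ℝ (Fin k)) ∘ₗ D.subtype) = ⊤ := by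
    rw [LinearMap.range_comp, Submodule.range_subtype, htop]
  obtain ⟨g, hg⟩ := LinearMap.exists_rightInverse_of_surjective _ hrange
  refine ⟨LinearMap.toContinuousLinearMap (D.subtype ∘ₗ g), fun c => ?_, fun c => ?_⟩
  · simp
  · simpa using LinearMap.congr_fun hg c

/-- **Dense subspaces meet regular zero sets.**  If `D` is a dense linear subspace of a real
Banach space `E` and `F : E → ℝᵏ` is `C¹` with `F x₀ = 0` and `fderiv ℝ F x₀` onto, then for
every `ε > 0` there is `d ∈ D` with `dist d x₀ < ε` and `F d = 0`. -/
theorem stub_denseMeetsFiniteCodim :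
    ∀ (E : Type) [NormedAddCommGroup E] [NormedSpace ℝ E] [CompleteSpace E] (k : ℕ)
      (D : Submodule ℝ E), Dense (D : Set E) →
      ∀ (F : E → EuclideanSpace ℝ (Fin k)) (x₀ : E), ContDiff ℝ 1 F → F x₀ = 0 →
        Function.Surjective (fderiv ℝ F x₀) →
        ∀ ε : ℝ, 0 < ε → ∃ d : E, d ∈ D ∧ dist d x₀ < ε ∧ F d = 0 := by
  intro E _ _ _ k D hD F x₀ hF hF0 hsurj ε hε
  -- Step 1: a continuous linear right inverse `R` of `A := DF(x₀)` with values in `D`.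
  obtain ⟨R, hRD, hAR⟩ := exists_rightInverse_mem D hD (fderiv ℝ F x₀) hsurj
  set A : E →L[ℝ] EuclideanSpace ℝ (Fin k) := fderiv ℝ F x₀ with hA_def
  -- Step 2: the approximation constant `c₀`, with `c₀ * ‖R‖ ≤ 1 / 2`.
  obtain ⟨t, ht, htR⟩ : ∃ t : ℝ, 0 < t ∧ t * ‖R‖ ≤ 1 / 2 := by
    refine ⟨1 / (2 * (‖R‖ + 1)), by positivity, ?_⟩
    rw [div_mul_eq_mul_div, one_mul, div_le_iff₀ (by positivity)]
    linarith [norm_nonneg R]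
  set c₀ : ℝ≥0 := ⟨t, ht.le⟩ with hc₀_def
  have hc₀ : (0 : ℝ≥0) < c₀ := NNReal.coe_pos.1 ht
  have hc₀R : (c₀ : ℝ) * ‖R‖ ≤ 1 / 2 := htR
  -- Step 3: strict differentiability: `F` approximates `A` near `x₀` with constant `c₀`.
  have hstrict : HasStrictFDerivAt F A x₀ := hF.contDiffAt.hasStrictFDerivAt one_ne_zero
  obtain ⟨s, hs, hFs⟩ := hstrict.approximates_deriv_on_nhds (Or.inr hc₀)
  obtain ⟨ρ, hρ, hball⟩ := Metric.mem_nhds_iff.1 hs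
  obtain ⟨m, hm, hmρ, hmε⟩ : ∃ m : ℝ, 0 < m ∧ m ≤ ρ ∧ m ≤ ε :=
    ⟨min ρ ε, lt_min hρ hε, min_le_left _ _, min_le_right _ _⟩
  -- Step 4: the radius `r` of the finite-dimensional ball, with `‖R‖ * r ≤ m / 2`.
  obtain ⟨r, hr, hRr⟩ : ∃ r : ℝ, 0 < r ∧ ‖R‖ * r ≤ m / 2 := by
    refine ⟨m / (2 * (‖R‖ + 1)), by positivity, ?_⟩
    rw [mul_div_assoc', div_le_div_iff₀ (by positivity) (by positivity)]
    nlinarith [norm_nonneg R, hm.le]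
  -- Step 5: a base point `x' ∈ D` close to `x₀` with `‖F x'‖ < r / 2`.
  obtain ⟨η, hη, hηF⟩ :=
    Metric.continuousAt_iff.1 (hF.continuous.continuousAt (x := x₀)) (r / 2) (by positivity)
  obtain ⟨x', hx'ball, hx'D⟩ := Metric.dense_iff.1 hD x₀ (min η (m / 2)) (by positivity)
  rw [Metric.mem_ball] at hx'ball
  have hx'η : dist x' x₀ < η := hx'ball.trans_le (min_le_left _ _)
  have hx'm : dist x' x₀ < m / 2 := hx'ball.trans_le (min_le_right _ _)
  have hFx' : ‖F x'‖ < r / 2 := by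
    have := hηF hx'η
    rwa [hF0, dist_zero_right] at this
  -- Step 6: the affine slice `u ↦ x' + R u` maps `closedBall 0 r` into `ball x₀ m ⊆ s`.
  have hin : ∀ u ∈ closedBall (0 : EuclideanSpace ℝ (Fin k)) r, dist (x' + R u) x₀ < m := by
    intro u hu
    rw [mem_closedBall_zero_iff] at hu
    have h1 : ‖R u‖ ≤ ‖R‖ * r := (R.le_opNorm u).trans (by gcongr)
    calc dist (x' + R u) x₀ = ‖(x' - x₀) + R u‖ := by rw [dist_eq_norm]; congr 1; abel
      _ ≤ ‖x' - x₀‖ + ‖R u‖ := norm_add_le _ _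
      _ < m / 2 + m / 2 := by rw [← dist_eq_norm]; linarith
      _ = m := by ring
  have hin_s : ∀ u ∈ closedBall (0 : EuclideanSpace ℝ (Fin k)) r, x' + R u ∈ s := fun u hu =>
    hball (Metric.mem_ball.2 ((hin u hu).trans_le hmρ))
  -- Step 7: `G u := F (x' + R u)` approximates the identity on `closedBall 0 r`.
  set G : EuclideanSpace ℝ (Fin k) → EuclideanSpace ℝ (Fin k) := fun u => F (x' + R u)
    with hG_def
  have hG : ApproximatesLinearOn G (ContinuousLinearMap.id ℝ (EuclideanSpace ℝ (Fin k)))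
      (closedBall 0 r) (c₀ * ‖R‖₊) := by
    intro u hu v hv
    have h1 := hFs (x' + R u) (hin_s u hu) (x' + R v) (hin_s v hv)
    have h2 : A ((x' + R u) - (x' + R v)) = u - v := by
      rw [add_sub_add_left_eq_sub, ← map_sub, hAR]
    have h3 : G u - G v - (ContinuousLinearMap.id ℝ (EuclideanSpace ℝ (Fin k))) (u - v) =
        F (x' + R u) - F (x' + R v) - A ((x' + R u) - (x' + R v)) := by
      rw [h2, ContinuousLinearMap.id_apply]
    rw [h3]
    calc ‖F (x' + R u) - F (x' + R v) - A ((x' + R u) - (x' + R v))‖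
        ≤ c₀ * ‖(x' + R u) - (x' + R v)‖ := h1
      _ = c₀ * ‖R (u - v)‖ := by rw [add_sub_add_left_eq_sub, map_sub]
      _ ≤ c₀ * (‖R‖ * ‖u - v‖) := by gcongr; exact R.le_opNorm _
      _ = ((c₀ * ‖R‖₊ : ℝ≥0) : ℝ) * ‖u - v‖ := by rw [NNReal.coe_mul, coe_nnnorm]; ring
  -- Step 8: quantitative surjectivity of `G` on `closedBall 0 r`.
  let I : (ContinuousLinearMap.id ℝ (EuclideanSpace ℝ (Fin k))).NonlinearRightInverse :=
    ⟨id, 1, fun y => by simp, fun y => by simp⟩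
  have hI : I.nnnorm = 1 := rfl
  have hsurjOn := hG.surjOn_closedBall_of_nonlinearRightInverse I (b := 0) hr.le Subset.rfl
  rw [hI, NNReal.coe_one, inv_one, NNReal.coe_mul, coe_nnnorm] at hsurjOn
  have hG0 : G 0 = F x' := by simp only [hG_def, map_zero, add_zero]
  have h0 : (0 : EuclideanSpace ℝ (Fin k)) ∈ closedBall (G 0) ((1 - c₀ * ‖R‖) * r) := by
    rw [Metric.mem_closedBall, dist_zero_left, hG0]
    have : r / 2 ≤ (1 - c₀ * ‖R‖) * r := by nlinarith
    linarith
  obtain ⟨u, hu, hGu⟩ := hsurjOn h0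
  exact ⟨x' + R u, D.add_mem hx'D (hRD u), (hin u hu).trans_le hmε, hGu⟩

end Summit.NavierStokesRegularity.NavierStokesRegularity.Theorems.PumpContinuationDenseMeetsFiniteCodim

end
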